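import Summits.QuantumFields.YangMills.Theorems.HyperbolicToTorus.Negative.SquareComplexEdges

/-!
# `HyperbolicToTorus` — negative side: a chart interior never contains a cone

Negative-side support for crux `stmt-QuantumFields-15827`
(`Summit.QuantumFields.YangMills.Theses.HyperbolicRegulator.HyperbolicToTorus`) and for the shared
`let Fam := …` vocabulary of route `HyperbolicRegulator` (also `CurvatureAnchor`, `CurvatureUniformity`).
Nothing here asserts a Theses statement.

The admissibility predicate of the route asks, at every flat vertex `x`, for an injective `ℤ²`-chart
`cV x` of the box `|a.1|, |a.2| ≤ k/4` sending grid edges to oriented edges (`cE x`) and unit grid squares to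
squares of the complex, in a square complex whose every edge lies in exactly two squares and whose squares
have injective vertex cycles. We prove the purely combinatorial fact behind the refuter's vacuity finding
(VETTING.md on the item, 2026-08-17; route-review R3, 2026-08-16):

* `card_edgesAt_ne_five_of_localChart` — if the 3 × 3 block of grid points around an offset is charted
  (nine distinct vertices, the twelve grid edges are edges with the displayed endpoints, the four unit
  squares are squares with the displayed edge sets), then the centre vertex does NOT have degree 5: it is
  not a cone. (Its four chart edges already exhaust the two squares through each of them, so a fifth edge
  would put one of them in a third square.)
* `card_edgesAt_ne_five_of_boxChart` — the same for every INTERIOR point `a` (`|a.1|, |a.2| ≤ R − 1`) of a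
  box chart of radius `R`, hypotheses in the exact shape of the route's chart axiom 9 (with `R = (k:ℤ)/4`,
  `st`/`en`/`nx` the route's lets: any `st`, `en` with `{st e, en e} = {σ e.1, τ e.1}` and any `nx` with
  `nx a 0 = (a.1+1, a.2)`, `nx a 1 = (a.1, a.2+1)`); instantiating it from the admissibility predicate
  `(Φ k j).1` is pure destructuring (checked in the refuter's evidence file ScratchApply.lean).

Consequence recorded on the item: with the flatness threshold `k / 4 < dist x c` equal to the box radius,
the intended `{4,5}_k` complexes have flat vertices whose forced chart interior contains a cone (offset
`(2, k/4 − 1)` from a corner cone, `k ≥ 12`), so they violate the chart axiom; the lemma is the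
model-independent half of that argument and survives the proposed restatement (`k / 2 <`).
-/

namespace Summit.QuantumFields.YangMills.Theorems.HyperbolicToTorus.Negative

open Finset

section LocalChart

variable {σ τ : ℕ → ℕ} {st en : ℕ × Bool → ℕ} {E Q : Finset ℕ} {bd : ℕ → Fin 4 → ℕ × Bool}
  {nx : ℤ × ℤ → Fin 2 → ℤ × ℤ}

/-- **A charted `3 × 3` block has a centre of degree `≠ 5`.** Square complex data on vertex set `ℕ`:
oriented edges `E` (`σ`/`τ` = source/target; `st`/`en` = start/end of flagged edges), squares `Q` with
boundaries `bd` whose edges are in `E`, consecutive, with injective vertex cycle (route axiom 2), every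
edge in exactly two squares (axiom 3). Chart data around one grid point: vertices `P d` for the nine
offsets `|d.1|, |d.2| ≤ 1`, pairwise distinct; the twelve grid edges `H d μ` are edges of `E` from `P d` to
`P (nx d μ)`; the four unit grid squares are squares of `Q` with the displayed edge sets (the shape of
route axiom 9). Then the centre `P (0,0)` is NOT incident to exactly five edges — in the route's
vocabulary, it is not a cone (`dg = 5`). Proof: the four chart edges at the centre are pairwise distinct
and each already lies in two of the four chart squares; a fifth edge at the centre lies in some square,
whose other edge at the centre is one of the four chart edges (degree count), giving that edge a third
square. [folklore] -/
theorem card_edgesAt_ne_five_of_localChart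
    (hpair : ∀ e : ℕ × Bool, ({st e, en e} : Finset ℕ) = {σ e.1, τ e.1})
    (hnx0 : ∀ a, nx a 0 = (a.1 + 1, a.2)) (hnx1 : ∀ a, nx a 1 = (a.1, a.2 + 1))
    (h2 : ∀ q ∈ Q, (∀ i, (bd q i).1 ∈ E) ∧ (∀ i, en (bd q i) = st (bd q (i + 1))) ∧
      Function.Injective (st ∘ bd q))
    (h3 : ∀ e ∈ E, (Q.filter fun q => ∃ i, (bd q i).1 = e).card = 2)
    (P : ℤ × ℤ → ℕ) (H : ℤ × ℤ → Fin 2 → ℕ × Bool)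
    (hinj : Set.InjOn P {d | |d.1| ≤ 1 ∧ |d.2| ≤ 1})
    (hH : ∀ (d : ℤ × ℤ) (μ : Fin 2), |d.1| ≤ 1 → |d.2| ≤ 1 → |(nx d μ).1| ≤ 1 → |(nx d μ).2| ≤ 1 →
      (H d μ).1 ∈ E ∧ st (H d μ) = P d ∧ en (H d μ) = P (nx d μ))
    (hS : ∀ d : ℤ × ℤ, |d.1| ≤ 1 → |d.2| ≤ 1 → |d.1 + 1| ≤ 1 → |d.2 + 1| ≤ 1 →
      ∃ q ∈ Q, Finset.univ.image (Prod.fst ∘ bd q) =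
        {(H d 0).1, (H (nx d 0) 1).1, (H (nx d 1) 0).1, (H d 1).1}) :
    (E.filter fun e => σ e = P (0, 0) ∨ τ e = P (0, 0)).card ≠ 5 := by
  classical
  intro h5
  -- distinct chart vertices
  have hP : ∀ d d' : ℤ × ℤ, |d.1| ≤ 1 → |d.2| ≤ 1 → |d'.1| ≤ 1 → |d'.2| ≤ 1 → d ≠ d' → P d ≠ P d' :=
    fun d d' h1 h2 h3 h4 hne heq => hne (hinj ⟨h1, h2⟩ ⟨h3, h4⟩ heq)
  -- the twelve chart edges: membership in `E` and endpoint sets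
  have hEdge : ∀ (d : ℤ × ℤ) (μ : Fin 2), |d.1| ≤ 1 → |d.2| ≤ 1 → |(nx d μ).1| ≤ 1 → |(nx d μ).2| ≤ 1 →
      (H d μ).1 ∈ E ∧ ({σ (H d μ).1, τ (H d μ).1} : Finset ℕ) = {P d, P (nx d μ)} :=
    fun d μ h1 h2 h3 h4 =>
    ⟨(hH d μ h1 h2 h3 h4).1, by
      rw [← hpair, (hH d μ h1 h2 h3 h4).2.1, (hH d μ h1 h2 h3 h4).2.2]⟩
  obtain ⟨hRE, hRends⟩ :=
    hEdge (0, 0) 0 (by norm_num) (by norm_num) (by norm_num [hnx0, hnx1]) (by norm_num [hnx0, hnx1])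
  obtain ⟨hUE, hUends⟩ :=
    hEdge (0, 0) 1 (by norm_num) (by norm_num) (by norm_num [hnx0, hnx1]) (by norm_num [hnx0, hnx1])
  obtain ⟨hLE, hLends⟩ :=
    hEdge (-1, 0) 0 (by norm_num) (by norm_num) (by norm_num [hnx0, hnx1]) (by norm_num [hnx0, hnx1])
  obtain ⟨hDE, hDends⟩ :=
    hEdge (0, -1) 1 (by norm_num) (by norm_num) (by norm_num [hnx0, hnx1]) (by norm_num [hnx0, hnx1])
  obtain ⟨-, h1ends⟩ :=
    hEdge (1, 0) 1 (by norm_num) (by norm_num) (by norm_num [hnx0, hnx1]) (by norm_num [hnx0, hnx1])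
  obtain ⟨-, h2ends⟩ :=
    hEdge (0, 1) 0 (by norm_num) (by norm_num) (by norm_num [hnx0, hnx1]) (by norm_num [hnx0, hnx1])
  obtain ⟨-, h3ends⟩ :=
    hEdge (-1, 1) 0 (by norm_num) (by norm_num) (by norm_num [hnx0, hnx1]) (by norm_num [hnx0, hnx1])
  obtain ⟨-, h4ends⟩ :=
    hEdge (-1, 0) 1 (by norm_num) (by norm_num) (by norm_num [hnx0, hnx1]) (by norm_num [hnx0, hnx1])
  obtain ⟨-, h5ends⟩ :=
    hEdge (-1, -1) 0 (by norm_num) (by norm_num) (by norm_num [hnx0, hnx1]) (by norm_num [hnx0, hnx1])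
  obtain ⟨-, h6ends⟩ :=
    hEdge (-1, -1) 1 (by norm_num) (by norm_num) (by norm_num [hnx0, hnx1]) (by norm_num [hnx0, hnx1])
  obtain ⟨-, h7ends⟩ :=
    hEdge (0, -1) 0 (by norm_num) (by norm_num) (by norm_num [hnx0, hnx1]) (by norm_num [hnx0, hnx1])
  obtain ⟨-, h8ends⟩ :=
    hEdge (1, -1) 1 (by norm_num) (by norm_num) (by norm_num [hnx0, hnx1]) (by norm_num [hnx0, hnx1])
  simp only [hnx0, hnx1] at hRends hUends hLends hDends h1ends h2ends h3ends h4ends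
  simp only [hnx0, hnx1] at h5ends h6ends h7ends h8ends
  norm_num at hRends hUends hLends hDends h1ends h2ends h3ends h4ends
  norm_num at h5ends h6ends h7ends h8ends
  -- the centre lies on the four inner edges and on none of the eight outer edges
  have hLends' : ({σ (H (-1, 0) 0).1, τ (H (-1, 0) 0).1} : Finset ℕ) = {P (0, 0), P (-1, 0)} := by rw [hLends, pair_comm]
  have hDends' : ({σ (H (0, -1) 1).1, τ (H (0, -1) 1).1} : Finset ℕ) = {P (0, 0), P (0, -1)} := by rw [hDends, pair_comm]
  have hvR : P (0, 0) ∈ ({σ (H (0, 0) 0).1, τ (H (0, 0) 0).1} : Finset ℕ) := by rw [hRends]; simp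
  have hvU : P (0, 0) ∈ ({σ (H (0, 0) 1).1, τ (H (0, 0) 1).1} : Finset ℕ) := by rw [hUends]; simp
  have hvL : P (0, 0) ∈ ({σ (H (-1, 0) 0).1, τ (H (-1, 0) 0).1} : Finset ℕ) := by rw [hLends]; simp
  have hvD : P (0, 0) ∈ ({σ (H (0, -1) 1).1, τ (H (0, -1) 1).1} : Finset ℕ) := by rw [hDends]; simp
  have hn10 : P (1, 0) ≠ P (0, 0) :=
    hP _ _ (by norm_num) (by norm_num) (by norm_num) (by norm_num) (by decide)
  have hn01 : P (0, 1) ≠ P (0, 0) :=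
    hP _ _ (by norm_num) (by norm_num) (by norm_num) (by norm_num) (by decide)
  have hnm0 : P (-1, 0) ≠ P (0, 0) :=
    hP _ _ (by norm_num) (by norm_num) (by norm_num) (by norm_num) (by decide)
  have hn0m : P (0, -1) ≠ P (0, 0) :=
    hP _ _ (by norm_num) (by norm_num) (by norm_num) (by norm_num) (by decide)
  have hn11 : P (1, 1) ≠ P (0, 0) :=
    hP _ _ (by norm_num) (by norm_num) (by norm_num) (by norm_num) (by decide)
  have hnm1 : P (-1, 1) ≠ P (0, 0) :=
    hP _ _ (by norm_num) (by norm_num) (by norm_num) (by norm_num) (by decide)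
  have hnmm : P (-1, -1) ≠ P (0, 0) :=
    hP _ _ (by norm_num) (by norm_num) (by norm_num) (by norm_num) (by decide)
  have hn1m : P (1, -1) ≠ P (0, 0) :=
    hP _ _ (by norm_num) (by norm_num) (by norm_num) (by norm_num) (by decide)
  have hv1 : P (0, 0) ∉ ({σ (H (1, 0) 1).1, τ (H (1, 0) 1).1} : Finset ℕ) := by rw [h1ends]; simp [hn10.symm, hn11.symm]
  have hv2 : P (0, 0) ∉ ({σ (H (0, 1) 0).1, τ (H (0, 1) 0).1} : Finset ℕ) := by rw [h2ends]; simp [hn01.symm, hn11.symm]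
  have hv3 : P (0, 0) ∉ ({σ (H (-1, 1) 0).1, τ (H (-1, 1) 0).1} : Finset ℕ) := by rw [h3ends]; simp [hnm1.symm, hn01.symm]
  have hv4 : P (0, 0) ∉ ({σ (H (-1, 0) 1).1, τ (H (-1, 0) 1).1} : Finset ℕ) := by rw [h4ends]; simp [hnm0.symm, hnm1.symm]
  have hv5 : P (0, 0) ∉ ({σ (H (-1, -1) 0).1, τ (H (-1, -1) 0).1} : Finset ℕ) := by rw [h5ends]; simp [hnmm.symm, hn0m.symm]
  have hv6 : P (0, 0) ∉ ({σ (H (-1, -1) 1).1, τ (H (-1, -1) 1).1} : Finset ℕ) := by rw [h6ends]; simp [hnmm.symm, hnm0.symm]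
  have hv7 : P (0, 0) ∉ ({σ (H (0, -1) 0).1, τ (H (0, -1) 0).1} : Finset ℕ) := by rw [h7ends]; simp [hn0m.symm, hn1m.symm]
  have hv8 : P (0, 0) ∉ ({σ (H (1, -1) 1).1, τ (H (1, -1) 1).1} : Finset ℕ) := by rw [h8ends]; simp [hn1m.symm, hn10.symm]
  -- an edge through the centre differs from every outer edge
  have hne_out : ∀ {f o : ℕ}, P (0, 0) ∈ ({σ f, τ f} : Finset ℕ) → P (0, 0) ∉ ({σ o, τ o} : Finset ℕ) → f ≠ o :=
    fun hf ho heq => ho (heq ▸ hf)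
  -- the four inner edges are pairwise distinct
  have hinner : ∀ {f g : ℕ} {b c : ℕ}, ({σ f, τ f} : Finset ℕ) = {P (0, 0), b} → ({σ g, τ g} : Finset ℕ) = {P (0, 0), c} →
      b ≠ P (0, 0) → b ≠ c → f ≠ g := by
    intro f g b c hf hg hb hbc heq
    apply hbc
    apply pair_eq_pair_left hb
    rw [← hf, ← hg, heq]
  have hRU : (H (0, 0) 0).1 ≠ (H (0, 0) 1).1 := hinner hRends hUends hn10
    (hP _ _ (by norm_num) (by norm_num) (by norm_num) (by norm_num) (by decide))
  have hRL : (H (0, 0) 0).1 ≠ (H (-1, 0) 0).1 := hinner hRends hLends' hn10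
    (hP _ _ (by norm_num) (by norm_num) (by norm_num) (by norm_num) (by decide))
  have hRD : (H (0, 0) 0).1 ≠ (H (0, -1) 1).1 := hinner hRends hDends' hn10
    (hP _ _ (by norm_num) (by norm_num) (by norm_num) (by norm_num) (by decide))
  have hUL : (H (0, 0) 1).1 ≠ (H (-1, 0) 0).1 := hinner hUends hLends' hn01
    (hP _ _ (by norm_num) (by norm_num) (by norm_num) (by norm_num) (by decide))
  have hUD : (H (0, 0) 1).1 ≠ (H (0, -1) 1).1 := hinner hUends hDends' hn01
    (hP _ _ (by norm_num) (by norm_num) (by norm_num) (by norm_num) (by decide))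
  have hLD : (H (-1, 0) 0).1 ≠ (H (0, -1) 1).1 := hinner hLends' hDends' hnm0
    (hP _ _ (by norm_num) (by norm_num) (by norm_num) (by norm_num) (by decide))
  -- the four chart squares
  obtain ⟨q4, hq4Q, hq4⟩ :=
    hS (0, 0) (by norm_num) (by norm_num) (by norm_num [hnx0, hnx1]) (by norm_num [hnx0, hnx1])
  obtain ⟨q2, hq2Q, hq2⟩ :=
    hS (-1, 0) (by norm_num) (by norm_num) (by norm_num [hnx0, hnx1]) (by norm_num [hnx0, hnx1])
  obtain ⟨q1, hq1Q, hq1⟩ :=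
    hS (-1, -1) (by norm_num) (by norm_num) (by norm_num [hnx0, hnx1]) (by norm_num [hnx0, hnx1])
  obtain ⟨q3, hq3Q, hq3⟩ :=
    hS (0, -1) (by norm_num) (by norm_num) (by norm_num [hnx0, hnx1]) (by norm_num [hnx0, hnx1])
  simp only [hnx0, hnx1] at hq4 hq2 hq1 hq3
  norm_num at hq4 hq2 hq1 hq3
  have memq : ∀ {q x : ℕ} {S : Finset ℕ}, Finset.univ.image (Prod.fst ∘ bd q) = S → x ∈ S →
      ∃ j, (bd q j).1 = x := fun hq hx => mem_image_fst_bd.1 (hq ▸ hx)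
  have nmemq : ∀ {q x : ℕ} {S : Finset ℕ}, Finset.univ.image (Prod.fst ∘ bd q) = S → x ∉ S →
      ¬ ∃ j, (bd q j).1 = x := fun hq hx h => hx (hq ▸ mem_image_fst_bd.2 h)
  -- the edges at the centre
  have hmemEv : ∀ {e : ℕ}, e ∈ E.filter (fun e => σ e = P (0, 0) ∨ τ e = P (0, 0)) ↔
      e ∈ E ∧ P (0, 0) ∈ ({σ e, τ e} : Finset ℕ) := by
    intro e; rw [mem_filter, mem_endpair_iff]
  have hA_sub : ({(H (0, 0) 0).1, (H (0, 0) 1).1, (H (-1, 0) 0).1, (H (0, -1) 1).1} : Finset ℕ) ⊆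
      E.filter (fun e => σ e = P (0, 0) ∨ τ e = P (0, 0)) := by
    intro e he
    simp only [mem_insert, mem_singleton] at he
    rcases he with rfl | rfl | rfl | rfl
    · exact hmemEv.2 ⟨hRE, hvR⟩
    · exact hmemEv.2 ⟨hUE, hvU⟩
    · exact hmemEv.2 ⟨hLE, hvL⟩
    · exact hmemEv.2 ⟨hDE, hvD⟩
  have hcardA :
      ({(H (0, 0) 0).1, (H (0, 0) 1).1, (H (-1, 0) 0).1, (H (0, -1) 1).1} : Finset ℕ).card = 4 := by
    rw [card_insert_of_notMem (by simp [hRU, hRL, hRD]), card_insert_of_notMem (by simp [hUL, hUD]),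
      card_insert_of_notMem (by simp [hLD]), card_singleton]
  -- a fifth edge `f` at the centre …
  obtain ⟨f, hfEv, hfA⟩ := exists_mem_notMem_of_card_lt_card
    (s := ({(H (0, 0) 0).1, (H (0, 0) 1).1, (H (-1, 0) 0).1, (H (0, -1) 1).1} : Finset ℕ))
    (t := E.filter (fun e => σ e = P (0, 0) ∨ τ e = P (0, 0))) (by rw [hcardA, h5]; norm_num)
  obtain ⟨hfE, hfv⟩ := hmemEv.1 hfEv
  simp only [mem_insert, mem_singleton, not_or] at hfA
  obtain ⟨hfR, hfU, hfL, hfD⟩ := hfA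
  -- … lies in some square `q5`, which has a second edge `f'` at the centre …
  have hne5 : (Q.filter fun q => ∃ i, (bd q i).1 = f).Nonempty := by
    rw [← card_pos, h3 f hfE]; norm_num
  obtain ⟨q5, hq5⟩ := hne5
  obtain ⟨hq5Q, i, hi⟩ := mem_filter.1 hq5
  obtain ⟨i', hf'ne, hf'E, hf'v⟩ :=
    exists_second_edge_at hpair (h2 q5 hq5Q).1 (h2 q5 hq5Q).2.1 (h2 q5 hq5Q).2.2 hi hfv
  have hf'Ev : (bd q5 i').1 ∈ E.filter (fun e => σ e = P (0, 0) ∨ τ e = P (0, 0)) :=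
    hmemEv.2 ⟨hf'E, hf'v⟩
  -- … which must be one of the four inner edges (degree count) …
  have hf'A : (bd q5 i').1 ∈
      ({(H (0, 0) 0).1, (H (0, 0) 1).1, (H (-1, 0) 0).1, (H (0, -1) 1).1} : Finset ℕ) := by
    by_contra hnot
    have hsub : insert (bd q5 i').1 (insert f
        ({(H (0, 0) 0).1, (H (0, 0) 1).1, (H (-1, 0) 0).1, (H (0, -1) 1).1} : Finset ℕ)) ⊆
        E.filter (fun e => σ e = P (0, 0) ∨ τ e = P (0, 0)) := by
      intro e he
      rcases mem_insert.1 he with rfl | he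
      · exact hf'Ev
      rcases mem_insert.1 he with rfl | he
      · exact hfEv
      · exact hA_sub he
    have hfA' : f ∉ ({(H (0, 0) 0).1, (H (0, 0) 1).1, (H (-1, 0) 0).1, (H (0, -1) 1).1} : Finset ℕ) := by
      simp [hfR, hfU, hfL, hfD]
    have hf'fA : (bd q5 i').1 ∉ insert f
        ({(H (0, 0) 0).1, (H (0, 0) 1).1, (H (-1, 0) 0).1, (H (0, -1) 1).1} : Finset ℕ) := by
      rw [mem_insert, not_or]; exact ⟨hf'ne, hnot⟩
    have hcard6 : (insert (bd q5 i').1 (insert f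
        ({(H (0, 0) 0).1, (H (0, 0) 1).1, (H (-1, 0) 0).1, (H (0, -1) 1).1} : Finset ℕ))).card = 6 := by
      rw [card_insert_of_notMem hf'fA, card_insert_of_notMem hfA', hcardA]
    have := card_le_card hsub
    rw [hcard6, h5] at this
    omega
  -- … but `f` lies in none of the four chart squares …
  have hfq4 : ¬ ∃ j, (bd q4 j).1 = f := by
    refine nmemq hq4 ?_
    simp only [mem_insert, mem_singleton, not_or]
    exact ⟨hfR, hne_out hfv hv1, hne_out hfv hv2, hfU⟩
  have hfq2 : ¬ ∃ j, (bd q2 j).1 = f := by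
    refine nmemq hq2 ?_
    simp only [mem_insert, mem_singleton, not_or]
    exact ⟨hfL, hfU, hne_out hfv hv3, hne_out hfv hv4⟩
  have hfq1 : ¬ ∃ j, (bd q1 j).1 = f := by
    refine nmemq hq1 ?_
    simp only [mem_insert, mem_singleton, not_or]
    exact ⟨hne_out hfv hv5, hfD, hfL, hne_out hfv hv6⟩
  have hfq3 : ¬ ∃ j, (bd q3 j).1 = f := by
    refine nmemq hq3 ?_
    simp only [mem_insert, mem_singleton, not_or]
    exact ⟨hne_out hfv hv7, hne_out hfv hv8, hfR, hfD⟩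
  have h54 : q5 ≠ q4 := fun heq => hfq4 (heq ▸ ⟨i, hi⟩)
  have h52 : q5 ≠ q2 := fun heq => hfq2 (heq ▸ ⟨i, hi⟩)
  have h51 : q5 ≠ q1 := fun heq => hfq1 (heq ▸ ⟨i, hi⟩)
  have h53 : q5 ≠ q3 := fun heq => hfq3 (heq ▸ ⟨i, hi⟩)
  -- … and the chart squares are pairwise distinct where needed
  have h43 : q4 ≠ q3 := by
    intro heq
    have hm : ∃ j, (bd q4 j).1 = (H (0, 0) 1).1 := memq hq4 (by simp)
    rw [heq] at hm
    refine nmemq hq3 ?_ hm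
    simp only [mem_insert, mem_singleton, not_or]
    exact ⟨hne_out hvU hv7, hne_out hvU hv8, hRU.symm, hUD⟩
  have h42 : q4 ≠ q2 := by
    intro heq
    have hm : ∃ j, (bd q4 j).1 = (H (0, 0) 0).1 := memq hq4 (by simp)
    rw [heq] at hm
    refine nmemq hq2 ?_ hm
    simp only [mem_insert, mem_singleton, not_or]
    exact ⟨hRL, hRU, hne_out hvR hv3, hne_out hvR hv4⟩
  have h21 : q2 ≠ q1 := by
    intro heq
    have hm : ∃ j, (bd q2 j).1 = (H (0, 0) 1).1 := memq hq2 (by simp)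
    rw [heq] at hm
    refine nmemq hq1 ?_ hm
    simp only [mem_insert, mem_singleton, not_or]
    exact ⟨hne_out hvU hv5, hUD, hUL, hne_out hvU hv6⟩
  have h13 : q1 ≠ q3 := by
    intro heq
    have hm : ∃ j, (bd q1 j).1 = (H (-1, 0) 0).1 := memq hq1 (by simp)
    rw [heq] at hm
    refine nmemq hq3 ?_ hm
    simp only [mem_insert, mem_singleton, not_or]
    exact ⟨hne_out hvL hv7, hne_out hvL hv8, hRL.symm, hLD⟩
  -- so `f'` lies in three distinct squares: contradiction with axiom 3
  simp only [mem_insert, mem_singleton] at hf'A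
  rcases hf'A with h | h | h | h
  · exact false_of_three_squares h3 hf'E hq5Q hq4Q hq3Q ⟨i', rfl⟩ (memq hq4 (by simp [h]))
      (memq hq3 (by simp [h])) h54 h53 h43
  · exact false_of_three_squares h3 hf'E hq5Q hq4Q hq2Q ⟨i', rfl⟩ (memq hq4 (by simp [h]))
      (memq hq2 (by simp [h])) h54 h52 h42
  · exact false_of_three_squares h3 hf'E hq5Q hq2Q hq1Q ⟨i', rfl⟩ (memq hq2 (by simp [h]))
      (memq hq1 (by simp [h])) h52 h51 h21
  · exact false_of_three_squares h3 hf'E hq5Q hq1Q hq3Q ⟨i', rfl⟩ (memq hq1 (by simp [h]))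
      (memq hq3 (by simp [h])) h51 h53 h13

/-- **A box chart has no cone in its interior** (the route's chart axiom, one base point). With `R` the
box radius (the route: `R = (k : ℤ) / 4`), `cVx`/`cEx` the vertex/edge charts at a flat base point in the
exact shape of axiom 9 of the `let Fam := …` vocabulary (injective on the box, grid edges ↦ oriented edges
with the right endpoints, unit grid squares ↦ squares with the right edge sets), and axioms 2–3 of the
square complex: every interior grid point `a` (`|a.1|, |a.2| ≤ R − 1`) is charted onto a vertex that is
NOT incident to exactly five edges, i.e. not a cone. Hence a flat vertex whose forced chart development
meets a cone at an interior box point admits no chart — the intended `{4,5}_k` families, flat threshold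
`k/4`, offset `(2, k/4 − 1)` from a corner cone, `k ≥ 12`. [folklore] -/
theorem card_edgesAt_ne_five_of_boxChart
    (hpair : ∀ e : ℕ × Bool, ({st e, en e} : Finset ℕ) = {σ e.1, τ e.1})
    (hnx0 : ∀ a, nx a 0 = (a.1 + 1, a.2)) (hnx1 : ∀ a, nx a 1 = (a.1, a.2 + 1))
    (h2 : ∀ q ∈ Q, (∀ i, (bd q i).1 ∈ E) ∧ (∀ i, en (bd q i) = st (bd q (i + 1))) ∧
      Function.Injective (st ∘ bd q))
    (h3 : ∀ e ∈ E, (Q.filter fun q => ∃ i, (bd q i).1 = e).card = 2)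
    (R : ℤ) (cVx : ℤ × ℤ → ℕ) (cEx : ℤ × ℤ → Fin 2 → ℕ × Bool)
    (hInj : Set.InjOn cVx {a | |a.1| ≤ R ∧ |a.2| ≤ R})
    (hEd : ∀ (a : ℤ × ℤ) (μ : Fin 2), (|a.1| ≤ R ∧ |a.2| ≤ R) → (|(nx a μ).1| ≤ R ∧ |(nx a μ).2| ≤ R) →
      (cEx a μ).1 ∈ E ∧ st (cEx a μ) = cVx a ∧ en (cEx a μ) = cVx (nx a μ))
    (hSq : ∀ a : ℤ × ℤ, (|a.1| ≤ R ∧ |a.2| ≤ R) → (|a.1 + 1| ≤ R ∧ |a.2 + 1| ≤ R) →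
      ∃ q ∈ Q, Finset.univ.image (Prod.fst ∘ bd q) =
        {(cEx a 0).1, (cEx (nx a 0) 1).1, (cEx (nx a 1) 0).1, (cEx a 1).1})
    (a : ℤ × ℤ) (ha1 : |a.1| ≤ R - 1) (ha2 : |a.2| ≤ R - 1) :
    (E.filter fun e => σ e = cVx a ∨ τ e = cVx a).card ≠ 5 := by
  have hnx : ∀ (d : ℤ × ℤ) (μ : Fin 2),
      nx (a.1 + d.1, a.2 + d.2) μ = (a.1 + (nx d μ).1, a.2 + (nx d μ).2) := by
    intro d μ
    fin_cases μ
    · simp [hnx0, add_assoc]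
    · simp [hnx1, add_assoc]
  -- box membership of translated offsets
  have hbox : ∀ {u w : ℤ}, |u| ≤ R - 1 → |w| ≤ 1 → |u + w| ≤ R := fun hu hw =>
    (abs_add_le _ _).trans (by linarith)
  have key := card_edgesAt_ne_five_of_localChart hpair hnx0 hnx1 h2 h3
    (fun d => cVx (a.1 + d.1, a.2 + d.2))
    (fun d μ => cEx (a.1 + d.1, a.2 + d.2) μ) ?_ ?_ ?_
  · simpa using key
  · intro d hd d' hd' heq
    have h := hInj ⟨hbox ha1 hd.1, hbox ha2 hd.2⟩ ⟨hbox ha1 hd'.1, hbox ha2 hd'.2⟩ heq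
    simp only [Prod.mk.injEq, add_right_inj] at h
    exact Prod.ext h.1 h.2
  · intro d μ h1 h2 h3 h4
    obtain ⟨hE, hs, he⟩ := hEd (a.1 + d.1, a.2 + d.2) μ ⟨hbox ha1 h1, hbox ha2 h2⟩
      (by rw [hnx]; exact ⟨hbox ha1 h3, hbox ha2 h4⟩)
    rw [hnx] at he
    exact ⟨hE, hs, he⟩
  · intro d h1 h2 h3 h4
    obtain ⟨q, hqQ, hq⟩ := hSq (a.1 + d.1, a.2 + d.2) ⟨hbox ha1 h1, hbox ha2 h2⟩
      ⟨by rw [add_assoc]; exact hbox ha1 h3, by rw [add_assoc]; exact hbox ha2 h4⟩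
    refine ⟨q, hqQ, ?_⟩
    rw [hq, hnx, hnx]

end LocalChart

end Summit.QuantumFields.YangMills.Theorems.HyperbolicToTorus.Negative
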